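import Literature.Barriers.FinalStateConjecture.ExtremalHorizonMultiplierIdentity
import HarnessLib

/-!
# Axisymmetry in the box formalism: independence of the azimuth `φ₀`
# (Aretakis 2012, §2: axisymmetric solutions on extremal Kerr)

(family `gr`; proving seat of `Literature.Barriers.FinalStateConjecture.Aretakis2012_pointwiseDecay`.
The near-horizon estimates of `ExtremalHorizonNEnergy*.lean` are stated on coordinate boxes at a
fixed Kerr-star azimuth `φ₀`; the quantities of the fact are integrals over the full shells
`[M, R] × S²`, i.e. over `φ₀ ∈ [0, 2π]` as well. For axisymmetric `Φ` the pulled-back function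
`G = Φ ∘ κ` satisfies `∂_{φ*} G = 0` off the axis (`separated_equations_starPull`), hence `G` and all
its coordinate derivatives are independent of `φ₀` off the axis; every density of the energy method
carries the factor `sin θ` and therefore takes the same values at `(t, r, θ, φ₀)` and `(t, r, θ, 0)`
for all `θ ∈ [0, π]`.)

* `Kerr.boxPoint_phi_eq`, `Kerr.hasDerivAt_comp_boxPoint_phi` — the `φ₀`-lines of the box;
* `Kerr.starPull_boxPoint_phi_indep` — for the class: `G(t, r, θ, φ₀) = G(t, r, θ, 0)` and
  `∂_iG(t, r, θ, φ₀) = ∂_iG(t, r, θ, 0)` (`i = 0, …, 3`) whenever `t ≥ 0`, `r ≥ M`, `sin θ ≠ 0`;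
* `Kerr.density_boxPoint_phi_indep` — for any density `F` vanishing where `sin θ = 0` and depending
  on `q` only through `(r, θ, G, ∂G)`: `F(p(φ₀; t, r, θ)) = F(p(0; t, r, θ))` for `t ≥ 0`, `r ≥ M`;
  `Kerr.box2_integral_phi_indep` — the integrated form.

Everything is proved; no named facts.

## References

* S. Aretakis, *Decay of axisymmetric solutions of the wave equation on extreme Kerr backgrounds*,
  J. Funct. Anal. 263 (2012) 2770–2831 (arXiv:1110.2006): §2.2–2.4 (key `Aretakis2012`).
-/

noncomputable section

open Real Set Filter MeasureTheory intervalIntegral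
open scoped Topology ContDiff Manifold

namespace Literature.Barriers.FinalStateConjecture.Kerr

open Literature.Geometry.Lorentzian
open Literature.Geometry.Lorentzian.Kerr.StarCoord

/-- The `φ₀`-lines of the box. [folklore] -/
theorem boxPoint_phi_eq (φ₀ t r θ : ℝ) : boxPoint φ₀ t r θ = boxPoint 0 t r θ + φ₀ • E4.basisVector 3 := by
  ext i
  rw [Kerr.add_smul_basisVector_apply]
  fin_cases i <;> simp [boxPoint]

/-- Derivative along the `φ₀`-lines: `∂_{φ₀} [H(t, r, θ, φ₀)] = ∂₃H`. [folklore] -/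
theorem hasDerivAt_comp_boxPoint_phi {H : E4 → ℝ} {φ₀ t r θ : ℝ}
    (hH : DifferentiableAt ℝ H (boxPoint φ₀ t r θ)) :
    HasDerivAt (fun φ ↦ H (boxPoint φ t r θ)) (pd 3 H (boxPoint φ₀ t r θ)) φ₀ := by
  have hline : HasDerivAt (fun φ : ℝ ↦ boxPoint φ t r θ) (E4.basisVector 3) φ₀ := by
    have hfun : (fun φ : ℝ ↦ boxPoint φ t r θ) = fun φ ↦ boxPoint 0 t r θ + φ • E4.basisVector 3 :=
      funext fun φ ↦ boxPoint_phi_eq φ t r θ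
    rw [hfun]
    simpa using ((hasDerivAt_id φ₀).smul_const (E4.basisVector 3)).const_add (boxPoint 0 t r θ)
  exact hH.hasFDerivAt.comp_hasDerivAt φ₀ hline

variable [Kerr.Facts] [Kerr.SliceFacts] {M r₀ : ℝ} {U₀ : Set (Kerr.region M r₀)} {Φ : E4 → ℝ}

/-- **`φ₀`-independence of `G = Φ ∘ κ` and its coordinate derivatives off the axis**, for `Φ`
smooth at the points of an open `U₀ ⊇ {r ≥ M, t* ≥ 0}` of the extremal Kerr region, invariant under
the axial rotations (where `r_BL > 0`) and solving the wave equation on `U₀`: for `t ≥ 0`, `r ≥ M`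
and `sin θ ≠ 0`, `G(t, r, θ, φ₀) = G(t, r, θ, 0)` and `∂_iG(t, r, θ, φ₀) = ∂_iG(t, r, θ, 0)` —
`∂_{φ*}G = 0` off the axis, the mean value theorem along the `φ₀`-line, and
`∂_{φ*}∂_iG = ∂_i∂_{φ*}G = 0`. [cite: Aretakis2012, §2.4] -/
theorem starPull_boxPoint_phi_indep (hM : 0 < M) (hr₀ : r₀ ∈ Set.Ioo 0 M) (hU₀ : IsOpen U₀)
    (hKU : {x : Kerr.region M r₀ | Kerr.rPlus M M ≤ Kerr.radius M (x : E4) ∧ 0 ≤ (x : E4) 0} ⊆ U₀)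
    (hΦ : ∀ x ∈ U₀, ContDiffAt ℝ ∞ Φ x)
    (haxi : ∀ (β : ℝ) (z : E4), 0 < Kerr.radius M z → Φ (E4.axialRotation β z) = Φ z)
    (hsol : ∀ x ∈ U₀, (Kerr.smoothMetric M M r₀).toPseudoRiemannianMetric.dalembertian
      (fun y : Kerr.region M r₀ ↦ Φ y) x = 0)
    {t r θ : ℝ} (ht : 0 ≤ t) (hr : M ≤ r) (hθ : sin θ ≠ 0) (φ₀ : ℝ) :
    Kerr.starPull M Φ (boxPoint φ₀ t r θ) = Kerr.starPull M Φ (boxPoint 0 t r θ) ∧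
      ∀ i : Fin 4, pd i (Kerr.starPull M Φ) (boxPoint φ₀ t r θ) = pd i (Kerr.starPull M Φ) (boxPoint 0 t r θ) := by
  obtain ⟨hr₀pos, hr₀M⟩ := hr₀
  obtain ⟨hWo, hGW, h3, -, -⟩ := separated_equations_starPull hU₀ hΦ haxi hsol
  set W : Set E4 := {q : E4 | 0 < q 1 ∧ Real.sin (q 2) ≠ 0 ∧ Kerr.starChart M q ∈ Subtype.val '' U₀} with hWdef
  set G : E4 → ℝ := Kerr.starPull M Φ with hGdef
  -- the whole `φ₀`-line lies in `W`
  have hK'reg : ∀ x : E4, Kerr.rPlus M M ≤ Kerr.radius M x ∧ 0 ≤ x 0 → x ∈ Kerr.region M r₀ := by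
    intro x hx
    rw [Kerr.mem_region]
    have h1 := hx.1
    rw [Kerr.rPlus_self] at h1
    exact max_lt (by linarith) (by linarith)
  have hmem : ∀ φ : ℝ, boxPoint φ t r θ ∈ W := by
    intro φ
    have hK := shellPoint_mem_horizonFutureSet hM ht hr θ φ
    refine ⟨hM.trans_le hr, by simpa using hθ, ?_⟩
    rw [starChart_boxPoint]
    exact ⟨⟨_, hK'reg _ hK⟩, hKU hK, rfl⟩
  have hdiff : ∀ φ : ℝ, DifferentiableAt ℝ G (boxPoint φ t r θ) := fun φ ↦
    (hGW.differentiableOn (by simp)).differentiableAt (hWo.mem_nhds (hmem φ))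
  -- (a) `G` is constant along the line
  have hGc : ∀ φ : ℝ, G (boxPoint φ t r θ) = G (boxPoint 0 t r θ) := by
    have hd : ∀ φ : ℝ, HasDerivAt (fun φ' ↦ G (boxPoint φ' t r θ)) 0 φ := by
      intro φ
      have h := hasDerivAt_comp_boxPoint_phi (hdiff φ)
      rwa [h3 (hmem φ), Pi.zero_apply] at h
    intro φ
    exact is_const_of_deriv_eq_zero (fun φ ↦ (hd φ).differentiableAt) (fun φ ↦ (hd φ).deriv) φ 0
  -- (b) the coordinate derivatives are constant along the line
  have hpdc : ∀ (i : Fin 4) (φ : ℝ), pd i G (boxPoint φ t r θ) = pd i G (boxPoint 0 t r θ) := by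
    intro i
    have hpi := contDiffOn_pd hWo hGW i
    have hdiffi : ∀ φ : ℝ, DifferentiableAt ℝ (pd i G) (boxPoint φ t r θ) := fun φ ↦
      (hpi.differentiableOn (by simp)).differentiableAt (hWo.mem_nhds (hmem φ))
    -- `∂₃ ∂_i G = ∂_i ∂₃ G = 0` on `W`
    have hzero : ∀ q ∈ W, pd 3 (pd i G) q = 0 := by
      intro q hq
      rw [pd_comm hWo hGW 3 i hq, pd_apply]
      have hev : pd 3 G =ᶠ[𝓝 q] fun _ ↦ (0 : ℝ) :=
        Filter.eventually_of_mem (hWo.mem_nhds hq) fun x hx ↦ by rw [h3 hx]; rfl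
      rw [hev.fderiv_eq]
      simp
    have hd : ∀ φ : ℝ, HasDerivAt (fun φ' ↦ pd i G (boxPoint φ' t r θ)) 0 φ := by
      intro φ
      have h := hasDerivAt_comp_boxPoint_phi (hdiffi φ)
      rwa [hzero _ (hmem φ)] at h
    intro φ
    exact is_const_of_deriv_eq_zero (fun φ ↦ (hd φ).differentiableAt) (fun φ ↦ (hd φ).deriv) φ 0
  exact ⟨hGc φ₀, fun i ↦ hpdc i φ₀⟩

/-- **Densities of the energy method do not depend on the azimuth `φ₀`** (axisymmetric class): if
`F : E4 → ℝ` vanishes where `sin θ = 0` and depends on `q` only through `(q₁, q₂, G(q), ∂G(q))`,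
`G = Φ ∘ κ`, then `F(p(φ₀; t, r, θ)) = F(p(0; t, r, θ))` for `t ≥ 0`, `r ≥ M`.
[cite: Aretakis2012, §2.4] -/
theorem density_boxPoint_phi_indep (hM : 0 < M) (hr₀ : r₀ ∈ Set.Ioo 0 M) (hU₀ : IsOpen U₀)
    (hKU : {x : Kerr.region M r₀ | Kerr.rPlus M M ≤ Kerr.radius M (x : E4) ∧ 0 ≤ (x : E4) 0} ⊆ U₀)
    (hΦ : ∀ x ∈ U₀, ContDiffAt ℝ ∞ Φ x)
    (haxi : ∀ (β : ℝ) (z : E4), 0 < Kerr.radius M z → Φ (E4.axialRotation β z) = Φ z)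
    (hsol : ∀ x ∈ U₀, (Kerr.smoothMetric M M r₀).toPseudoRiemannianMetric.dalembertian
      (fun y : Kerr.region M r₀ ↦ Φ y) x = 0)
    {F : E4 → ℝ} (hF0 : ∀ q : E4, sin (q 2) = 0 → F q = 0)
    (hFdep : ∀ q q' : E4, q 1 = q' 1 → q 2 = q' 2 →
      Kerr.starPull M Φ q = Kerr.starPull M Φ q' →
      (∀ i : Fin 4, pd i (Kerr.starPull M Φ) q = pd i (Kerr.starPull M Φ) q') → F q = F q')
    {t r θ : ℝ} (ht : 0 ≤ t) (hr : M ≤ r) (φ₀ : ℝ) :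
    F (boxPoint φ₀ t r θ) = F (boxPoint 0 t r θ) := by
  by_cases hθ : sin θ = 0
  · rw [hF0 _ (by simpa using hθ), hF0 _ (by simpa using hθ)]
  · obtain ⟨hG, hpd⟩ := starPull_boxPoint_phi_indep hM hr₀ hU₀ hKU hΦ haxi hsol ht hr hθ φ₀
    exact hFdep _ _ rfl rfl hG hpd

/-- **Box integrals do not depend on the azimuth** (integrated form of
`density_boxPoint_phi_indep`): for a density `F` as there, `t ≥ 0` and `M ≤ a ≤ b`,
`∫₀^π∫_a^b F(p(φ₀; t, r, θ)) = ∫₀^π∫_a^b F(p(0; t, r, θ))`. [cite: Aretakis2012, §2.4] -/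
theorem box2_integral_phi_indep (hM : 0 < M) (hr₀ : r₀ ∈ Set.Ioo 0 M) (hU₀ : IsOpen U₀)
    (hKU : {x : Kerr.region M r₀ | Kerr.rPlus M M ≤ Kerr.radius M (x : E4) ∧ 0 ≤ (x : E4) 0} ⊆ U₀)
    (hΦ : ∀ x ∈ U₀, ContDiffAt ℝ ∞ Φ x)
    (haxi : ∀ (β : ℝ) (z : E4), 0 < Kerr.radius M z → Φ (E4.axialRotation β z) = Φ z)
    (hsol : ∀ x ∈ U₀, (Kerr.smoothMetric M M r₀).toPseudoRiemannianMetric.dalembertian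
      (fun y : Kerr.region M r₀ ↦ Φ y) x = 0)
    {F : E4 → ℝ} (hF0 : ∀ q : E4, sin (q 2) = 0 → F q = 0)
    (hFdep : ∀ q q' : E4, q 1 = q' 1 → q 2 = q' 2 →
      Kerr.starPull M Φ q = Kerr.starPull M Φ q' →
      (∀ i : Fin 4, pd i (Kerr.starPull M Φ) q = pd i (Kerr.starPull M Φ) q') → F q = F q')
    {t a b : ℝ} (ht : 0 ≤ t) (ha : M ≤ a) (hab : a ≤ b) (φ₀ : ℝ) :
    (∫ θ in (0 : ℝ)..π, ∫ r in a..b, F (boxPoint φ₀ t r θ)) =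
      ∫ θ in (0 : ℝ)..π, ∫ r in a..b, F (boxPoint 0 t r θ) := by
  refine intervalIntegral.integral_congr fun θ _ ↦ intervalIntegral.integral_congr fun r hr ↦ ?_
  rw [uIcc_of_le hab] at hr
  exact density_boxPoint_phi_indep hM hr₀ hU₀ hKU hΦ haxi hsol hF0 hFdep ht (ha.trans hr.1) φ₀

end Literature.Barriers.FinalStateConjecture.Kerr

end
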